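import Summits.ResolutionOfSingularities.ResolutionOfSingularities.Theorems.FrobeniusLadderFInjectiveMacaulayficationFiniteResidualOfIsolatedGerm
import HarnessLib

/-!
# FC″ at isolated-singularity curve germs ON 4-FOLDS: the binder `hcurve` discharged by the dimension count
# (crux `FInjectiveMacaulayfication` stmt-ResolutionOfSingularities-15315, chain w45a; res-L1-w45a-plan-1 R16.47 (2) note «`hcurve` … in a 4-fold with
# `ringKrullDim 𝒪_η = 3` this is automatic … prove or assume»; res-L1-w45a-tri-2 note (β) «`ringKrullDim 𝒪_η = 3` makes `closure {η}` a CURVE only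
# when `dim X₁ = 4`»; seat res-L1-w45a-lead-1 g7)

[OURS · L1 W4.5a] Support file (`--supports stmt-ResolutionOfSingularities-15315 --as helper`); replaces the role of NO printed item; NOT a statement of
the manuscript; def-free; AI-written (AI review is weaker than expert review).

* `isClosed_singleton_of_mem_closure_of_dim` (unconditional, any scheme): if `dim X ≤ d + 1` and `dim 𝒪_{X,η} = d`, every point of
  `closure {η}` other than `η` is a CLOSED point. Proof (specialisation order of Mathlib, `x ≤ y ↔ y ⤳ x`; `coheight x = dim 𝒪_{X,x}`, Stacks 02IZ
  = Mathlib `ringKrullDim_stalk_eq_coheight`): a proper specialisation `x < η` has `coheight x ≥ d + 1`, and `height x + coheight x ≤ dim X ≤ d + 1`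
  (`coe_height_add_coheight_le_topologicalKrullDim`), so `height x = 0`, i.e. `x` is minimal for specialisation, i.e. closed.
* `fcUnguarded_at_isolatedCurve_of_absorbingStepNC_dimFour`: `FiniteResidualOfIsolatedGerm.fcUnguarded_at_isolatedCurve_of_absorbingStepNC` on a
  scheme of dimension EXACTLY `4` (binder `topologicalKrullDim X₁ ≤ 4` added to FC″'s `4 ≤ topologicalKrullDim X₁`), WITHOUT the binder `hcurve`.
[cite: StacksProject, Tag 02IZ] [folklore]
-/

-- single-problem summit: the doubled namespace component is forced
set_option linter.dupNamespace false

noncomputable section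

namespace Summit.ResolutionOfSingularities.ResolutionOfSingularities.Theorems.FInjectiveMacaulayfication.FiniteResidualOfIsolatedGermDimFour

open CategoryTheory AlgebraicGeometry TopologicalSpace IsLocalRing
open Literature.AlgebraicGeometry.Resolution Literature.AlgebraicGeometry.CossartPiltant200819
open Summit.ResolutionOfSingularities.ResolutionOfSingularities.Theorems.FInjectiveMacaulayfication
open SliceableCentre FCUnguardedAprime

/-- **Proper specialisations of a point of local dimension `d` on a scheme of dimension `≤ d + 1` are closed points.** [folklore]
[cite: StacksProject, Tag 02IZ] -/
theorem isClosed_singleton_of_mem_closure_of_dim {X : Scheme.{0}} {d : ℕ} (hX : topologicalKrullDim X ≤ (d + 1 : ℕ))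
    {η : X} (hη : ringKrullDim (X.presheaf.stalk η) = d) {x : X} (hx : x ∈ closure ({η} : Set X)) (hxη : x ≠ η) :
    IsClosed ({x} : Set X) := by
  -- `coheight η = d`
  have hcoh : Order.coheight η = d := by
    have h := ringKrullDim_stalk_eq_coheight η
    rw [hη] at h
    exact_mod_cast h.symm
  -- `x < η` in the specialisation order
  have hsp : η ⤳ x := specializes_iff_mem_closure.mpr hx
  have hlt : x < η := lt_of_le_not_ge (Scheme.le_iff_specializes.mpr hsp) fun h' =>
    hxη (Specializes.antisymm (Scheme.le_iff_specializes.mp h') hsp).eq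
  have h1 : Order.coheight η + 1 ≤ Order.coheight x := Order.coheight_add_one_le hlt
  have h2 : ((Order.height x + Order.coheight x : ℕ∞) : WithBot ℕ∞) ≤ (d + 1 : ℕ) :=
    (coe_height_add_coheight_le_topologicalKrullDim x).trans hX
  have h3 : Order.height x + Order.coheight x ≤ (d + 1 : ℕ) := by exact_mod_cast h2
  rw [hcoh] at h1
  -- hence `height x = 0`
  have hcx : Order.coheight x ≠ ⊤ := by
    intro htop
    rw [htop, add_top] at h3
    exact absurd h3 (by simp)
  obtain ⟨m, hm⟩ := ENat.ne_top_iff_exists.mp hcx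
  have hhx : Order.height x ≠ ⊤ := by
    intro htop
    rw [htop, top_add] at h3
    exact absurd h3 (by simp)
  obtain ⟨a, ha⟩ := ENat.ne_top_iff_exists.mp hhx
  rw [← hm] at h1 h3
  rw [← ha] at h3
  have h1' : d + 1 ≤ m := by exact_mod_cast h1
  have h3' : a + m ≤ d + 1 := by exact_mod_cast h3
  have ha0 : a = 0 := by omega
  have hmin : IsMin x := by
    rw [← Order.height_eq_zero, ← ha, ha0]
    rfl
  -- a minimal point for specialisation is closed
  have hcl : closure ({x} : Set X) = {x} := by
    refine Set.Subset.antisymm (fun y hy => ?_) subset_closure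
    have hxy : x ⤳ y := specializes_iff_mem_closure.mpr hy
    have hyx : y ≤ x := Scheme.le_iff_specializes.mpr hxy
    have hxy' : x ≤ y := hmin hyx
    exact Set.mem_singleton_iff.mpr (Specializes.antisymm (Scheme.le_iff_specializes.mp hxy') hxy).eq
  rw [← hcl]
  exact isClosed_closure

/-- **FC″ AT ISOLATED-SINGULARITY CURVE GERMS ON 4-FOLDS, modulo (T3ᵃ′)** — `fcUnguarded_at_isolatedCurve_of_absorbingStepNC` with
`topologicalKrullDim X₁ ≤ 4` in place of the binder `hcurve` (on a 4-fold the proper specialisations of a point of local dimension `3` are closed).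
[OURS · conditional on the CANDIDATE (T3ᵃ′) and on CP 1.1 / R–G / CP 4.4 / `NonFullLocusClosed` BY NAME]
[cite: CossartPiltant2019, Thm. 1.1 (i)(ii); Prop. 4.4] [cite: DattaMurayama2024, Thm. B] [cite: StacksProject, Tag 02IZ] -/
theorem fcUnguarded_at_isolatedCurve_of_absorbingStepNC_dimFour (h : AbsorbingStep.AbsorbingClosedPointStepNC)
    (hG : CossartPiltant2019General.{0}) (h081R : Stacks081R.{0}) (hP : CossartPiltant2019Principalization.{0})
    (hNF : NonFullLocusClosed.NonFullLocusClosed)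
    (p : ℕ) (hp : p.Prime) (k : Type) [Field k] [CharP k p] (X₁ : Scheme.{0}) (f₁ : X₁ ⟶ Spec (.of k))
    (hs : IsSeparated f₁) (hft : LocallyOfFiniteType f₁) (hqc : QuasiCompact f₁) (hi : IsIntegral X₁) (h4 : 4 ≤ topologicalKrullDim X₁)
    (h4' : topologicalKrullDim X₁ ≤ 4)
    (hCM : ∀ x : X₁, (∀ d : ℕ, ringKrullDim (X₁.presheaf.stalk x) = d → ∀ s : Fin d → X₁.presheaf.stalk x,
        (Ideal.span (Set.range s)).radical.IsMaximal → RingTheory.Sequence.IsWeaklyRegular (X₁.presheaf.stalk x) (List.ofFn s)))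
    (η : X₁)
    (hη : ¬ IsClosed ({η} : Set X₁) ∧ ¬ (∀ d : ℕ, ringKrullDim (X₁.presheaf.stalk η) = d → ∀ s : Fin d → X₁.presheaf.stalk η,
          (Ideal.span (Set.range s)).radical.IsMaximal → ∀ t : X₁.presheaf.stalk η, (∃ e : ℕ, t ^ p ^ e ∈
            Ideal.span ((fun z : X₁.presheaf.stalk η => z ^ p ^ e) '' (Ideal.span (Set.range s) : Set (X₁.presheaf.stalk η)))) →
              t ∈ Ideal.span (Set.range s)) ∧
        ∀ y : X₁, y ⤳ η → y ≠ η → (∀ d : ℕ, ringKrullDim (X₁.presheaf.stalk y) = d → ∀ s : Fin d → X₁.presheaf.stalk y,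
          (Ideal.span (Set.range s)).radical.IsMaximal → ∀ t : X₁.presheaf.stalk y, (∃ e : ℕ, t ^ p ^ e ∈
            Ideal.span ((fun z : X₁.presheaf.stalk y => z ^ p ^ e) '' (Ideal.span (Set.range s) : Set (X₁.presheaf.stalk y)))) →
              t ∈ Ideal.span (Set.range s)))
    (hdim : ringKrullDim (X₁.presheaf.stalk η) = 3)
    (hreg : ∀ x : X₁, x ⤳ η → x ≠ η → IsRegularLocalRing (X₁.presheaf.stalk x))
    (V : X₁.Opens) (hCV : closure ({η} : Set X₁) ⊆ (V : Set X₁))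
    (hfull : ∀ x : X₁, x ∈ (V : Set X₁) → x ∉ closure ({η} : Set X₁) → FullCl p (X₁.presheaf.stalk x)) :
    ∃ (J : X₁.IdealSheafData) (n' : ℕ) (c' : Fin n' → X₁.presheaf.stalk η), J ≠ ⊥ ∧ η ∈ (J.support : Set X₁) ∧
      Ideal.span (Set.range c') ≠ ⊥ ∧ Ideal.span (Set.range c') ≤ maximalIdeal (X₁.presheaf.stalk η) ∧
        (∀ (j : Fin n') (𝔔 : PrimeSpectrum (blowupAlgebra (Ideal.span (Set.range c')) (c' j))),
          𝔔.asIdeal.comap (algebraMap (X₁.presheaf.stalk η) (blowupAlgebra (Ideal.span (Set.range c')) (c' j))) =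
            maximalIdeal (X₁.presheaf.stalk η) →
          IsDomain (Localization.AtPrime 𝔔.asIdeal) ∧ ∀ d : ℕ, ringKrullDim (Localization.AtPrime 𝔔.asIdeal) = d →
            ∀ s : Fin d → Localization.AtPrime 𝔔.asIdeal, (Ideal.span (Set.range s)).radical.IsMaximal →
              RingTheory.Sequence.IsWeaklyRegular (Localization.AtPrime 𝔔.asIdeal) (List.ofFn s) ∧
              ∀ y : Localization.AtPrime 𝔔.asIdeal, (∃ e : ℕ, y ^ p ^ e ∈ Ideal.span ((fun z : Localization.AtPrime 𝔔.asIdeal => z ^ p ^ e) ''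
                (Ideal.span (Set.range s) : Set (Localization.AtPrime 𝔔.asIdeal)))) → y ∈ Ideal.span (Set.range s)) ∧
      stalkIdeal J η = Ideal.span (Set.range c') ∧
      (∀ (X₂ : Scheme.{0}) (π : X₂ ⟶ X₁), IsBlowup π J →
        (∀ x : X₂, π.base x ∈ (J.support : Set X₁) → π.base x ≠ η → ¬ IsClosed ({x} : Set X₂) →
          IsDomain (X₂.presheaf.stalk x) ∧ ∀ d : ℕ, ringKrullDim (X₂.presheaf.stalk x) = d → ∀ s : Fin d → X₂.presheaf.stalk x,
            (Ideal.span (Set.range s)).radical.IsMaximal → RingTheory.Sequence.IsWeaklyRegular (X₂.presheaf.stalk x) (List.ofFn s) ∧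
            ∀ t : X₂.presheaf.stalk x, (∃ e : ℕ, t ^ p ^ e ∈ Ideal.span ((fun z : X₂.presheaf.stalk x => z ^ p ^ e) ''
              (Ideal.span (Set.range s) : Set (X₂.presheaf.stalk x)))) → t ∈ Ideal.span (Set.range s)) ∧
        (∀ x : X₂, π.base x ∈ (J.support : Set X₁) → IsClosed ({x} : Set X₂) →
          ∀ d : ℕ, ringKrullDim (X₂.presheaf.stalk x) = d → ∀ s : Fin d → X₂.presheaf.stalk x,
            (Ideal.span (Set.range s)).radical.IsMaximal → RingTheory.Sequence.IsWeaklyRegular (X₂.presheaf.stalk x) (List.ofFn s))) :=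
  FiniteResidualOfIsolatedGerm.fcUnguarded_at_isolatedCurve_of_absorbingStepNC h hG h081R hP hNF p hp k X₁ f₁ hs hft hqc hi h4 hCM η hη hdim
    hreg V hCV hfull (fun _ hx hxη => isClosed_singleton_of_mem_closure_of_dim (d := 3) h4' hdim hx hxη)

end Summit.ResolutionOfSingularities.ResolutionOfSingularities.Theorems.FInjectiveMacaulayfication.FiniteResidualOfIsolatedGermDimFour

end
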